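import Literature.NumberTheory.LFunctions.Zhang2022.RepairBandSlot
import Literature.NumberTheory.LFunctions.Zhang2022.RepairRplusSmoothLengths

/-!
# Zhang (2022) §18-margin repair rung — barrier extension `R⁺⁺`, slice «smooth profiles of any length», the
# FROM-THE-WALL family: wall value zero, band slot E-004 DISPLAYED (discrete-mean currency)

Trunk T-ANT (NumberTheory/LFunctions). Y. Zhang, *Discrete mean estimates and the Landau–Siegel
zero*, arXiv:2211.02515v1 (2022) [Zhang2022LandauSiegel] — **an unrefereed manuscript under
adjudication. WHAT THIS IS NOT: nothing here asserts or denies its Theorems 1–2 or any analytic lemma;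
no claim about Landau–Siegel zeros, about Parity, or about a repaired `Margin232` is made.** Cell
`landau-siegel` (rung F-S3), sub-cell E, seat ls-barrier-p2 (stubs S-E-p2-1/2 of `barrier/ASSIGNMENTS.md`): the
discrete-mean counterpart of `Repair.familyTwoPiece` (p455670, `X`-world, slot `KnifeEdge.InvisibleOverhang`
displayed) — here the displayed slot is the BAND slot of record `Repair.DiscMeanBandWidthWall0` (p458872, registry
E-004, wall value zero), and the verdict compares the polynomial of ANY length `N ≥ ⌈P^{1+w}⌉` with its BULK below the
wall `n < ⌈P⌉` (not merely two lengths beyond `P^{1+ε}` as in `familySmoothLengths`/`familySmoothTop`, p457377).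

* `WallZeroDesign` `d = (c′, g)`; class `WallZeroDesign.InClass d`: `g` globally 1-Lipschitz, `‖g‖∞ ≤ 1`, and WALL
  VALUE ZERO `g(1) = 0` (the class text of OBJECTIVE §1.3 row `R⁺ \ R̄` as ruled by REF-B1, bus 2026-08-26T16:56:30Z:
  `KnifeEdge.InClassPiece.vanish`/`OverhangPiece.vanish`; profiles with `g(1) ≠ 0` carry the band main term E-005
  and are OUTSIDE). Verdict `WallZeroDesign.Verdict d`: for every `0 < w < δ` and every constant `C`, IF the band
  slot `DiscMeanBandWidthWall0 c′ w C` holds (kind (c), displayed, never asserted), then for all large `D`, every real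
  primitive `χ (mod D)`, under the displayed (A)-hypothesis `Re ρ = ½` (kind (b)), for EVERY length
  `⌈P^{1+w}⌉ ≤ N ≤ ⌈P^{1+δ}⌉`: no main-order gain over the bulk,
  `¬ (C·w·(discMeanAbs(⌈P⌉) + discWeight) + P^{−w/8}·(discMeanAbs(⌈P^{1+w}⌉) + discWeight) < |discMean(N) − discMean(⌈P⌉)|)`
  — `familyWallZero`, decided (`familyWallZero_decided`) by `Repair.discMean_fromWall_of_bandWidthWall0`.
* `WallZeroTopDesign` (+ a length `θ` with `g = 0` on `[θ, ∞)`): the same for EVERY `N ≥ ⌈P^{1+w}⌉` (the full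
  polynomial), via `discMean_fromWall_topVanishing_of_bandWidthOn` (proved here) — `familyWallZeroTop`,
  `familyWallZeroTop_decided`.
* C2: `WallZeroDesign` members are `SmoothDesign` members with `K = M = 1` (`inClass_toSmooth`); C4: the
  TRIANGULAR overhang `y ↦ max 0 (min (y − 1) (θ − y))` for `1 ≤ θ ≤ 3` (wall value `0`, top value `0`, height
  `(θ−1)/2 ≤ 1`, globally 1-Lipschitz) is a member of both classes (`inClass_triangle`, `inClassTop_triangle`).
* `rplus_wallZero_decided : ClassDecided (Rplus ++ [familyWallZero, familyWallZeroTop])`.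

Reading: «closing past the wall in the smooth wall-value-zero class, in the discrete-mean currency, needs ¬(E-004
slot)» — the band is the only undecided object of this class. CURRENCY (REF-E C3(e)): discrete mean over the sampled
zeros; (b) and (c) displayed; nothing about (A)-world main terms, nothing about the size of `C`.

## References

* Y. Zhang, arXiv:2211.02515v1 (2022), §2 (2.14)–(2.20), (2.30), §7 (7.2) [p. 44], §8 Lemma 8.1.
  [cite: Zhang2022LandauSiegel, §§2, 7, 8]
-/

noncomputable section

open Real Complex
open scoped NNReal

namespace Literature.NumberTheory.LFunctions.Zhang2022

namespace Repair

/-! ### The top-vanishing chain for a slot over a class (companion of `discMean_fromWall_of_bandWidthOn`) -/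

/-- **From the wall to the FULL polynomial of a top-vanishing piece, conditionally on the band slot over a class `V`
of profiles 1-Lipschitz and bounded by `1` on `[1, ∞)`:** slot on `V` and `0 < w < δ` give, eventually and under the
displayed (A)-hypothesis, for every `g` with `V g` vanishing on `[θ, ∞)`, `θ ≤ 1 + δ`, and EVERY `N ≥ ⌈P^{1+w}⌉`:
`|discMean(N) − discMean(⌈P⌉)| ≤ C·w·(discMeanAbs(⌈P⌉) + discWeight) + P^{−w/8}·(discMeanAbs(⌈P^{1+w}⌉) + discWeight)`.
[cite: Zhang2022LandauSiegel, §2 (2.16)–(2.20); §8 Lemma 8.1] -/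
theorem discMean_fromWall_topVanishing_of_bandWidthOn {V : (ℝ → ℂ) → Prop} (c' : ℝ) {w δ C : ℝ} (hw : 0 < w)
    (hwδ : w < δ) (hV : ∀ g, V g → LipschitzOnWith 1 g (Set.Ici 1) ∧ ∀ z : ℝ, 1 ≤ z → ‖g z‖ ≤ 1)
    (hB : DiscMeanBandWidthOn V c' w C) :
    Skeleton.ForAllLarge fun D _ χ =>
      (∀ i ∈ Skeleton.idx χ, (i.2).re = 1 / 2) →
        ∀ g : ℝ → ℂ, V g → ∀ θ : ℝ, θ ≤ 1 + δ → (∀ z, θ ≤ z → g z = 0) →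
          ∀ N : ℕ, ⌈Skeleton.bigP D ^ (1 + w)⌉₊ ≤ N →
            |discMean c' χ g N - discMean c' χ g ⌈Skeleton.bigP D⌉₊| ≤
              C * w * (discMeanAbs c' χ g ⌈Skeleton.bigP D⌉₊ + discWeight c' χ) +
                Skeleton.bigP D ^ (-(w / 8)) *
                  (discMeanAbs c' χ g ⌈Skeleton.bigP D ^ (1 + w)⌉₊ + discWeight c' χ) := by
  refine (Skeleton.ForAllLarge.and hB (discMean_flat_topVanishing c' hw hwδ)).mono ?_
  intro D _ χ _ _ h hA g hg θ hθ hg0 N hN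
  have h1 := h.1 hA g hg
  have h2 := h.2 hA g 1 1 (hV g hg).1 (hV g hg).2 θ hθ hg0 N hN
  have h2' : |discMean c' χ g N - discMean c' χ g ⌈Skeleton.bigP D ^ (1 + w)⌉₊| ≤
      Skeleton.bigP D ^ (-(w / 8)) * (discMeanAbs c' χ g ⌈Skeleton.bigP D ^ (1 + w)⌉₊ + discWeight c' χ) := by
    simpa using h2
  calc |discMean c' χ g N - discMean c' χ g ⌈Skeleton.bigP D⌉₊|
      = |(discMean c' χ g ⌈Skeleton.bigP D ^ (1 + w)⌉₊ - discMean c' χ g ⌈Skeleton.bigP D⌉₊) +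
          (discMean c' χ g N - discMean c' χ g ⌈Skeleton.bigP D ^ (1 + w)⌉₊)| := by ring_nf
    _ ≤ |discMean c' χ g ⌈Skeleton.bigP D ^ (1 + w)⌉₊ - discMean c' χ g ⌈Skeleton.bigP D⌉₊| +
          |discMean c' χ g N - discMean c' χ g ⌈Skeleton.bigP D ^ (1 + w)⌉₊| := abs_add_le _ _
    _ ≤ _ := add_le_add h1 h2'

/-! ### Family «wall value zero, from the wall to any length, band slot displayed» -/

/-- A design of the from-the-wall family: shift parameter `c′` and the FULL profile `g` (bulk and overhang).
[cite: Zhang2022LandauSiegel, §2 (2.23); §7 (7.2) p.44] -/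
structure WallZeroDesign where
  /-- the shift parameter `c′` of `𝔠*` -/
  c' : ℝ
  /-- the full profile `g(z)`, `z = log n / log P` -/
  g : ℝ → ℂ

/-- **Class predicate** (regularity + wall value, NO analytic hypothesis): `g` globally 1-Lipschitz, `‖g‖∞ ≤ 1`,
`g(1) = 0`. [cite: Zhang2022LandauSiegel, §7 (7.2) p.44] -/
def WallZeroDesign.InClass (d : WallZeroDesign) : Prop :=
  LipschitzWith 1 d.g ∧ (∀ z, ‖d.g z‖ ≤ 1) ∧ d.g 1 = 0

/-- **Verdict** «no main-order gain over the bulk below `P` at ANY length `⌈P^{1+w}⌉ ≤ N ≤ ⌈P^{1+δ}⌉», for every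
`0 < w < δ` and every `C`, with the band slot `DiscMeanBandWidthWall0 c′ w C` (kind (c)) and the (A)-hypothesis
(kind (b)) DISPLAYED. [cite: Zhang2022LandauSiegel, §2 (2.16)–(2.20); §8 Lemma 8.1] -/
def WallZeroDesign.Verdict (d : WallZeroDesign) : Prop :=
  ∀ ⦃w δ C : ℝ⦄, 0 < w → w < δ → DiscMeanBandWidthWall0 d.c' w C →
    Skeleton.ForAllLarge fun D _ χ =>
      (∀ i ∈ Skeleton.idx χ, (i.2).re = 1 / 2) →
        ∀ N : ℕ, ⌈Skeleton.bigP D ^ (1 + w)⌉₊ ≤ N → N ≤ ⌈Skeleton.bigP D ^ (1 + δ)⌉₊ →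
          ¬ (C * w * (discMeanAbs d.c' χ d.g ⌈Skeleton.bigP D⌉₊ + discWeight d.c' χ) +
                Skeleton.bigP D ^ (-(w / 8)) *
                  (discMeanAbs d.c' χ d.g ⌈Skeleton.bigP D ^ (1 + w)⌉₊ + discWeight d.c' χ) <
              |discMean d.c' χ d.g N - discMean d.c' χ d.g ⌈Skeleton.bigP D⌉₊|)

/-- **The slice theorem** `∀ d, K d → V d` (from the wall, band slot displayed).
[cite: Zhang2022LandauSiegel, §2 (2.16)–(2.20); §8 Lemma 8.1] -/
theorem WallZeroDesign.verdict_of_inClass (d : WallZeroDesign) (h : d.InClass) : d.Verdict := by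
  intro w δ C hw hwδ hB
  refine (discMean_fromWall_of_bandWidthWall0 d.c' hw hwδ hB).mono ?_
  intro D _ χ _ _ hflat hA N hN₁ hN₂
  exact not_lt.2 (hflat hA d.g h.1 h.2.1 h.2.2 N hN₁ hN₂)

/-- family «wall value zero, from the wall to any bounded length, band slot displayed, discrete-mean currency».
[cite: Zhang2022LandauSiegel, §2 (2.16)–(2.20); §8 Lemma 8.1] -/
def familyWallZero : DesignFamily where
  Design := WallZeroDesign
  InClass := WallZeroDesign.InClass
  Verdict := WallZeroDesign.Verdict

/-- **`familyWallZero` is decided.** [cite: Zhang2022LandauSiegel, §2 (2.16)–(2.20); §8 Lemma 8.1] -/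
theorem familyWallZero_decided : familyWallZero.Decided :=
  fun d h => WallZeroDesign.verdict_of_inClass d h

/-! ### Family «wall value zero, TOP-VANISHING, the full polynomial, band slot displayed» -/

/-- A from-the-wall design with a declared length `θ` (`g = 0` on `[θ, ∞)`). [cite: Zhang2022LandauSiegel, §7 (7.2) p.44] -/
structure WallZeroTopDesign extends WallZeroDesign where
  /-- the logarithmic length `θ` (`len = P^θ`) -/
  θ : ℝ

/-- **Class predicate**: wall-value-zero class AND `g = 0` on `[θ, ∞)`. [cite: Zhang2022LandauSiegel, §7 (7.2) p.44] -/
def WallZeroTopDesign.InClass (d : WallZeroTopDesign) : Prop :=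
  d.toWallZeroDesign.InClass ∧ ∀ z : ℝ, d.θ ≤ z → d.g z = 0

/-- **Verdict** «the FULL polynomial (every `N ≥ ⌈P^{1+w}⌉`) gains nothing at main order over the bulk below `P`», for
every `w > 0` and `C`, band slot and (A)-hypothesis displayed. [cite: Zhang2022LandauSiegel, §2 (2.16)–(2.20)] -/
def WallZeroTopDesign.Verdict (d : WallZeroTopDesign) : Prop :=
  ∀ ⦃w C : ℝ⦄, 0 < w → DiscMeanBandWidthWall0 d.c' w C →
    Skeleton.ForAllLarge fun D _ χ =>
      (∀ i ∈ Skeleton.idx χ, (i.2).re = 1 / 2) →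
        ∀ N : ℕ, ⌈Skeleton.bigP D ^ (1 + w)⌉₊ ≤ N →
          ¬ (C * w * (discMeanAbs d.c' χ d.g ⌈Skeleton.bigP D⌉₊ + discWeight d.c' χ) +
                Skeleton.bigP D ^ (-(w / 8)) *
                  (discMeanAbs d.c' χ d.g ⌈Skeleton.bigP D ^ (1 + w)⌉₊ + discWeight d.c' χ) <
              |discMean d.c' χ d.g N - discMean d.c' χ d.g ⌈Skeleton.bigP D⌉₊|)

/-- **The slice theorem** for the top-vanishing from-the-wall family (`δ = |θ − 1| + 2w`).
[cite: Zhang2022LandauSiegel, §2 (2.16)–(2.20); §8 Lemma 8.1] -/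
theorem WallZeroTopDesign.verdict_of_inClass (d : WallZeroTopDesign) (h : d.InClass) : d.Verdict := by
  intro w C hw hB
  have hwδ : w < |d.θ - 1| + 2 * w := by have := abs_nonneg (d.θ - 1); linarith
  have hθ : d.θ ≤ 1 + (|d.θ - 1| + 2 * w) := by have := le_abs_self (d.θ - 1); linarith
  have hV : ∀ g : ℝ → ℂ, (LipschitzWith 1 g ∧ (∀ z, ‖g z‖ ≤ 1) ∧ g 1 = 0) →
      LipschitzOnWith 1 g (Set.Ici 1) ∧ ∀ z : ℝ, 1 ≤ z → ‖g z‖ ≤ 1 :=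
    fun g hg => ⟨hg.1.lipschitzOnWith, fun z _ => hg.2.1 z⟩
  refine (discMean_fromWall_topVanishing_of_bandWidthOn d.c' hw hwδ hV hB).mono ?_
  intro D _ χ _ _ hflat hA N hN
  exact not_lt.2 (hflat hA d.g h.1 d.θ hθ h.2 N hN)

/-- family «wall value zero, top-vanishing, full polynomial vs bulk, band slot displayed».
[cite: Zhang2022LandauSiegel, §2 (2.16)–(2.20); §8 Lemma 8.1] -/
def familyWallZeroTop : DesignFamily where
  Design := WallZeroTopDesign
  InClass := WallZeroTopDesign.InClass
  Verdict := WallZeroTopDesign.Verdict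

/-- **`familyWallZeroTop` is decided.** [cite: Zhang2022LandauSiegel, §2 (2.16)–(2.20); §8 Lemma 8.1] -/
theorem familyWallZeroTop_decided : familyWallZeroTop.Decided :=
  fun d h => WallZeroTopDesign.verdict_of_inClass d h

/-! ### C2 / C4 -/

/-- C2: a wall-value-zero design is a smooth design with `K = M = 1` (its `familySmoothLengths` verdict holds too).
[cite: Zhang2022LandauSiegel, §7 (7.2) p.44] -/
theorem WallZeroDesign.inClass_toSmooth (d : WallZeroDesign) (h : d.InClass) :
    (SmoothDesign.mk d.c' 1 1 d.g).InClass :=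
  ⟨h.1.lipschitzOnWith, fun z _ => h.2.1 z⟩

/-- C4: the TRIANGULAR overhang `g(y) = max 0 (min (y − 1) (θ − y))` (wall value `0`, top value `0`, height `(θ−1)/2`),
for `1 ≤ θ ≤ 3`, is a member of the wall-value-zero class (globally 1-Lipschitz, `‖g‖ ≤ 1`, `g(1) = 0`).
[cite: Zhang2022LandauSiegel, §7 (7.2) p.44] -/
theorem inClass_triangle (c' : ℝ) {θ : ℝ} (hθ : 1 ≤ θ) (hθ3 : θ ≤ 3) :
    (WallZeroDesign.mk c' fun y => ((max 0 (min (y - 1) (θ - y)) : ℝ) : ℂ)).InClass := by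
  refine ⟨?_, ?_, ?_⟩
  · have h1 : LipschitzWith 1 fun y : ℝ => y - 1 := LipschitzWith.mk_one fun a b => by
      rw [Real.dist_eq, Real.dist_eq, show a - 1 - (b - 1) = a - b by ring]
    have h2 : LipschitzWith 1 fun y : ℝ => θ - y := LipschitzWith.mk_one fun a b => by
      rw [Real.dist_eq, Real.dist_eq, show θ - a - (θ - b) = -(a - b) by ring, abs_neg]
    have h3 : LipschitzWith (max 1 1) fun y : ℝ => max 0 (min (y - 1) (θ - y)) := (h1.min h2).const_max 0
    exact (Complex.isometry_ofReal.lipschitz.comp h3).weaken (by simp)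
  · intro z
    dsimp only
    rw [Complex.norm_real, Real.norm_eq_abs, abs_of_nonneg (le_max_left _ _)]
    rcases le_total (z - 1) (θ - z) with h | h
    · rw [min_eq_left h]; exact max_le zero_le_one (by linarith)
    · rw [min_eq_right h]; exact max_le zero_le_one (by linarith)
  · show (((max 0 (min ((1:ℝ) - 1) (θ - 1))) : ℝ) : ℂ) = 0
    rw [sub_self, min_eq_left (by linarith)]
    simp

/-- C4: the same triangular overhang, with declared length `θ`, is a member of the top-vanishing wall-value-zero class.
[cite: Zhang2022LandauSiegel, §7 (7.2) p.44] -/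
theorem inClassTop_triangle (c' : ℝ) {θ : ℝ} (hθ : 1 ≤ θ) (hθ3 : θ ≤ 3) :
    (WallZeroTopDesign.mk ⟨c', fun y => ((max 0 (min (y - 1) (θ - y)) : ℝ) : ℂ)⟩ θ).InClass := by
  refine ⟨inClass_triangle c' hθ hθ3, fun z hz => ?_⟩
  show (((max 0 (min (z - 1) (θ - z))) : ℝ) : ℂ) = 0
  rw [max_eq_left ((min_le_right _ _).trans (by linarith))]
  simp

/-! ### The extension step -/

/-- **`R⁺⁺`-step of this file**: `ClassDecided (Rplus ++ [familyWallZero, familyWallZeroTop])`.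
[cite: Zhang2022LandauSiegel, §2 (2.32)–(2.33); §7 (7.2) p.44] -/
theorem rplus_wallZero_decided : ClassDecided (Rplus ++ [familyWallZero, familyWallZeroTop]) :=
  classDecided_append.2
    ⟨rplus_decided, classDecided_cons familyWallZero_decided
      (classDecided_cons familyWallZeroTop_decided classDecided_nil)⟩

end Repair

end Literature.NumberTheory.LFunctions.Zhang2022
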